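import Summits.CriticalPhenomena.SAWScalingLimit.Theorems.SAWDefectDecoherenceBoundaryClosureRGateDbarFloor
import HarnessLib

/-!
# Gate `∂̄`-limit, III: the boundary (gate dart) term at one mesh
(crux `BoundaryClosureR`, stmt-CriticalPhenomena-14004, line `polygon-parity-squeeze`, registered
stub `stub_gateDbarLimit`, mechanism (C))

In the discrete Green identity at scale `δ` (`HexObservableLimitR.greenLimit_identity`, weight
`φ(δ c_v)`) the BOUNDARY term is the dart sum `6 δ Σ_{v ∈ Λ, u ∼ v, u ∉ Λ} φ(δ c_v)(mid − c_v)F({v,u})/F(b)`.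
For `φ` supported in the quarter gate ball `B(c, ρ/4)` of a family pinned at `c` (exact half-lattice
`{v | m ≤ v.1 1}` on `B(c, ρ)`), at ONE mesh: the darts that see `φ` are the vertical FLOOR DARTS of
the gate row, indexed by columns (`dartSum_eq_finsum_window`, via `GateMass.boundaryWindow_eq_image`),
all with `mid − c_v = c/2`, `3c = −i√3`; between two window columns the floor is flat and pinned
(`mem_window_between`, `floor_between`), so `F_{5/8}(e_k)/F_{5/8}(b) = Z(e_k)/Z(b)` for the
normaliser `b = e_{k_b}` (`GateTrace.dartRatio_eq_massRatio`); hence (`boundary_term_at`)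
`6δ·(dart sum) = −i√3 · δ Σ_k φ(δ c_{v_k}) Z(e_k)/Z(b)`, and trading `φ(δ c_{v_k})` for `φ(δ·mid e_k)`
(the form of `GateProfileAt`) costs `≤ √3 (L_φ δ/2) · δ Σ_k β(δ mid e_k) Z(e_k)/Z(b)` for any
majorant `β ≥ 1` near the support.  The limit `δ → 0⁺` is taken in `…GateDbarLimit.lean`.
Reference: Duminil-Copin–Smirnov, Ann. of Math. 175 (2012), §3 (boundary mid-edges, winding).
-/

noncomputable section

open scoped BigOperators Topology Classical ComplexConjugate
open Filter Set Metric Complex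
open Literature.Probability.LatticeModels Literature.Probability.RandomPlanarGeometry
open Literature.Probability.RandomPlanarGeometry.SAW
open Literature.Barriers.CriticalPhenomena.HexGreen (nbrs mem_nbrs_iff)
open Literature.Barriers.CriticalPhenomena.HexKernel (vecA vecC unitE1)
open Summit.CriticalPhenomena.SAWScalingLimit.Theorems.PickHalfPlane
open Summit.CriticalPhenomena.SAWScalingLimit.Theorems.DecoherenceSynthesis (norm_hexMidpoint_sub_hexCenter_le)
open Summit.CriticalPhenomena.SAWScalingLimit.Theorems.ObservableToSLE.FloorRatio (dist_smul_mesh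
  dist_hexCenter_hexMidpoint_le)
open Summit.CriticalPhenomena.SAWScalingLimit.Cruxes.DefectDecoherence.TipMartingaleDepthInduction.WallExitTwoPoint
  (dist_hexCenter_le_one_of_adj)

namespace Summit.CriticalPhenomena.SAWScalingLimit.Theorems.PolygonParitySqueeze.GateDbar

/-! ### 4. The boundary term at one mesh -/

/-- **The boundary term at one mesh.** Data at mesh `δ` (`0 < δ`, `ρ/4 + 2δ ≤ ρ`): a simply
connected `Λ` rooted at the boundary dart `{u, w}` whose scaled midpoint is at distance `≥ ρ` from
`c`, pinned at `c` (radius `ρ`); the normaliser `b` is the floor dart of a column `k_b` of the window;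
`φ` is `L`-Lipschitz and vanishes off `B(c, ρφ)`, `ρφ + δ ≤ ρ/4`; `β ≥ 0` is `≥ 1` on `B(c, ρφ + δ/2)`.
Then `6δ·(dart sum of φ(δ c_v)(mid − c_v)F/F(b))` differs from `−i√3 · δ Σ_{window} φ(δ mid e) Z(e)/Z(b)`
by at most `√3 (Lδ/2) · δ Σ_{window} β(δ mid e) Z(e) / Z(b)`.
[cite: DuminilCopinSmirnov2012, §3 (winding of walks to the boundary)] -/
theorem boundary_term_at {Λ : Finset HexVertex} (hΛ : hexDomainSimplyConnected Λ) {u w : HexVertex}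
    (huw : hexGraph.Adj u w) (hu : u ∉ Λ) (hw : w ∈ Λ) {m : ℤ} {δ ρ : ℝ} {c : ℂ} (hδ : 0 < δ)
    (hρδ : ρ / 4 + 2 * δ ≤ ρ)
    (hpin : ∀ y : HexVertex, (δ : ℂ) * hexCenter y ∈ ball c ρ → (y ∈ Λ ↔ m ≤ y.1 1))
    (hfar : ρ ≤ dist ((δ : ℂ) * hexMidpoint s(u, w)) c) {kb : ℤ}
    (hkb : (δ : ℂ) * hexMidpoint
      s((((![kb, m - 1] : Site 2)), (1 : Fin 2)), ((![kb, m] : Site 2), (0 : Fin 2))) ∈ ball c (ρ / 4))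
    {φ : ℂ → ℂ} {L ρφ : ℝ} (hL : 0 ≤ L) (hφL : ∀ x y, ‖φ x - φ y‖ ≤ L * ‖x - y‖)
    (hφs : ∀ z, φ z ≠ 0 → z ∈ ball c ρφ) (hρφ : ρφ + δ ≤ ρ / 4)
    {β : ℂ → ℝ} (hβ0 : ∀ z, 0 ≤ β z) (hβ1 : ∀ z ∈ ball c (ρφ + δ / 2), 1 ≤ β z) :
    ‖6 * ((δ : ℂ) * ∑ v ∈ Λ, ∑ t ∈ (nbrs v).filter (· ∉ Λ),
          φ ((δ : ℂ) * hexCenter v) * ((hexMidpoint s(v, t) - hexCenter v) *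
            hexParafermionicObservable Λ s(u, w) hexCriticalFugacity (5 / 8) s(v, t)) /
            hexParafermionicObservable Λ s(u, w) hexCriticalFugacity (5 / 8)
              s((((![kb, m - 1] : Site 2)), (1 : Fin 2)), ((![kb, m] : Site 2), (0 : Fin 2)))) -
        -(I * (Real.sqrt 3 : ℂ)) * ((δ : ℂ) *
          ∑ᶠ e ∈ {e : Sym2 HexVertex | e ∈ hexDomainBoundary Λ ∧ (δ : ℂ) * hexMidpoint e ∈ ball c (ρ / 4)},
            φ ((δ : ℂ) * hexMidpoint e) *
              (hexParafermionicObservable Λ s(u, w) hexCriticalFugacity 0 e /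
                hexParafermionicObservable Λ s(u, w) hexCriticalFugacity 0
                  s((((![kb, m - 1] : Site 2)), (1 : Fin 2)), ((![kb, m] : Site 2), (0 : Fin 2)))))‖ ≤
      Real.sqrt 3 * (L * δ / 2) * ((δ *
        ∑ᶠ e ∈ {e : Sym2 HexVertex | e ∈ hexDomainBoundary Λ ∧ (δ : ℂ) * hexMidpoint e ∈ ball c (ρ / 4)},
          β ((δ : ℂ) * hexMidpoint e) * ‖hexParafermionicObservable Λ s(u, w) hexCriticalFugacity 0 e‖) /
        ‖hexParafermionicObservable Λ s(u, w) hexCriticalFugacity 0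
          s((((![kb, m - 1] : Site 2)), (1 : Fin 2)), ((![kb, m] : Site 2), (0 : Fin 2)))‖) := by
  classical
  set F : Sym2 HexVertex → ℂ := hexParafermionicObservable Λ s(u, w) hexCriticalFugacity (5 / 8) with hFdef
  set Z : Sym2 HexVertex → ℂ := hexParafermionicObservable Λ s(u, w) hexCriticalFugacity 0 with hZdef
  set ek : ℤ → Sym2 HexVertex := fun k =>
    s((((![k, m - 1] : Site 2)), (1 : Fin 2)), ((![k, m] : Site 2), (0 : Fin 2))) with hek
  set top : ℤ → HexVertex := fun k => (((![k, m] : Site 2)), (0 : Fin 2)) with htop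
  set bot : ℤ → HexVertex := fun k => (((![k, m - 1] : Site 2)), (1 : Fin 2)) with hbot
  set Kw : Set ℤ := {k : ℤ | (δ : ℂ) * hexMidpoint (ek k) ∈ ball c (ρ / 4)} with hKw
  have hS : ∀ z ∈ ball c (ρ / 4), dist z c + δ / 2 < ρ := fun z hz => by
    have := mem_ball.1 hz; linarith
  have hKf : Kw.Finite := GateMass.finite_intWindow hδ.le hpin hS
  have hρδ' : ρ / 4 + δ / 2 < ρ := by linarith
  have hkb' : kb ∈ Kw := hkb
  rw [show s((((![kb, m - 1] : Site 2)), (1 : Fin 2)), ((![kb, m] : Site 2), (0 : Fin 2))) = ek kb from rfl]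
  -- (1) the dart sum over the window
  set G : HexVertex → HexVertex → ℂ := fun v t =>
    φ ((δ : ℂ) * hexCenter v) * ((hexMidpoint s(v, t) - hexCenter v) * F s(v, t)) / F (ek kb) with hG
  have hG0 : ∀ v t : HexVertex, hexGraph.Adj v t → v ∈ Λ → t ∉ Λ →
      (δ : ℂ) * hexMidpoint s(v, t) ∉ ball c (ρ / 4) → G v t = 0 := by
    intro v t hadj _ _ hnot
    have hφ0 : φ ((δ : ℂ) * hexCenter v) = 0 := by
      by_contra hne
      apply hnot
      have hv := hφs _ hne
      rw [mem_ball] at hv ⊢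
      have hd : dist ((δ : ℂ) * hexMidpoint s(v, t)) ((δ : ℂ) * hexCenter v) ≤ δ / 2 := by
        rw [dist_smul_mesh hδ.le, dist_eq_norm]
        exact (mul_le_mul_of_nonneg_left (norm_hexMidpoint_sub_hexCenter_le hadj) hδ.le).trans (by linarith)
      linarith [dist_triangle ((δ : ℂ) * hexMidpoint s(v, t)) ((δ : ℂ) * hexCenter v) c]
    simp only [hG, hφ0, zero_mul, zero_div]
  have hdart := dartSum_eq_finsum_window hδ.le hpin hρδ' G hG0
  -- (2) window darts: direction and phase
  have hwin : ∀ k ∈ Kw, G (top k) (bot k) = φ ((δ : ℂ) * hexCenter (top k)) * (vecC / 2) *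
      (Z (ek k) / Z (ek kb)) := by
    intro k hk
    have hmin : min k kb ∈ Kw := by
      rcases le_total k kb with h | h
      · rw [min_eq_left h]; exact hk
      · rw [min_eq_right h]; exact hkb'
    have hmax : max k kb ∈ Kw := by
      rcases le_total k kb with h | h
      · rw [max_eq_right h]; exact hkb'
      · rw [max_eq_left h]; exact hk
    -- the flat floor between `k` and `kb`, off the root
    have hfl := floor_between hδ.le hpin hρδ hmin hmax
    have hroot : ∀ j : ℤ, min k kb ≤ j → j ≤ max k kb → ek j ≠ s(u, w) := by
      intro j hj₁ hj₂ hje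
      have hj : (δ : ℂ) * hexMidpoint (ek j) ∈ ball c (ρ / 4) := mem_window_between hj₁ hj₂ hmin hmax
      rw [hje] at hj
      have := mem_ball.1 hj
      linarith
    have hratio := GateTrace.dartRatio_eq_massRatio hΛ huw hu hw hfl hroot
      (min_le_right k kb) (le_max_right k kb) (min_le_left k kb) (le_max_left k kb)
    -- direction of the dart
    have hdir : hexMidpoint s(top k, bot k) - hexCenter (top k) = vecC / 2 :=
      hexMidpoint_floorDart_sub_center k m
    have hswap : s(top k, bot k) = ek k := Sym2.eq_swap
    have hG' : G (top k) (bot k) = φ ((δ : ℂ) * hexCenter (top k)) * (vecC / 2) * (F (ek k) / F (ek kb)) := by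
      simp only [hG]
      rw [hdir, hswap]
      ring
    rw [hG']
    congr 1
  -- (3) both sides as sums over the window
  have hX : ∑ᶠ e ∈ {e : Sym2 HexVertex | e ∈ hexDomainBoundary Λ ∧ (δ : ℂ) * hexMidpoint e ∈ ball c (ρ / 4)},
      φ ((δ : ℂ) * hexMidpoint e) * (Z e / Z (ek kb)) =
      ∑ᶠ k ∈ Kw, φ ((δ : ℂ) * hexMidpoint (ek k)) * (Z (ek k) / Z (ek kb)) :=
    GateMass.finsum_boundaryWindow_eq hδ.le hpin hS _
  have hB : ∑ᶠ e ∈ {e : Sym2 HexVertex | e ∈ hexDomainBoundary Λ ∧ (δ : ℂ) * hexMidpoint e ∈ ball c (ρ / 4)},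
      β ((δ : ℂ) * hexMidpoint e) * ‖Z e‖ = ∑ᶠ k ∈ Kw, β ((δ : ℂ) * hexMidpoint (ek k)) * ‖Z (ek k)‖ :=
    GateMass.finsum_boundaryWindow_eq hδ.le hpin hS _
  have hT : ∑ v ∈ Λ, ∑ t ∈ (nbrs v).filter (· ∉ Λ), G v t =
      ∑ k ∈ hKf.toFinset, φ ((δ : ℂ) * hexCenter (top k)) * (vecC / 2) * (Z (ek k) / Z (ek kb)) := by
    rw [hdart, finsum_mem_eq_finite_toFinset_sum _ hKf]
    exact Finset.sum_congr rfl fun k hk => hwin k (hKf.mem_toFinset.1 hk)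
  -- the statement's dart sum is the sum of `G`
  have hGsum : (δ : ℂ) * ∑ v ∈ Λ, ∑ t ∈ (nbrs v).filter (· ∉ Λ),
      φ ((δ : ℂ) * hexCenter v) * ((hexMidpoint s(v, t) - hexCenter v) * F s(v, t)) / F (ek kb) =
      (δ : ℂ) * ∑ v ∈ Λ, ∑ t ∈ (nbrs v).filter (· ∉ Λ), G v t := by simp only [hG]
  rw [hGsum, hT, hX, hB, finsum_mem_eq_finite_toFinset_sum _ hKf, finsum_mem_eq_finite_toFinset_sum _ hKf]
  -- (4) the difference, term by term
  have hkey : 6 * ((δ : ℂ) * ∑ k ∈ hKf.toFinset, φ ((δ : ℂ) * hexCenter (top k)) * (vecC / 2) *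
        (Z (ek k) / Z (ek kb))) -
      -(I * (Real.sqrt 3 : ℂ)) * ((δ : ℂ) * ∑ k ∈ hKf.toFinset, φ ((δ : ℂ) * hexMidpoint (ek k)) *
        (Z (ek k) / Z (ek kb))) =
      (3 * vecC) * ((δ : ℂ) * ∑ k ∈ hKf.toFinset,
        (φ ((δ : ℂ) * hexCenter (top k)) - φ ((δ : ℂ) * hexMidpoint (ek k))) * (Z (ek k) / Z (ek kb))) := by
    rw [← three_mul_vecC]
    simp only [Finset.mul_sum, ← Finset.sum_sub_distrib]
    refine Finset.sum_congr rfl fun k _ => ?_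
    ring
  rw [hkey, norm_mul, norm_three_mul_vecC, mul_assoc (Real.sqrt 3)]
  refine mul_le_mul_of_nonneg_left ?_ (Real.sqrt_nonneg 3)
  rw [norm_mul, Complex.norm_real, Real.norm_of_nonneg hδ.le]
  -- each term: `‖φ(δ c_top) − φ(δ mid)‖ ≤ (Lδ/2) β(δ mid)`
  have hterm : ∀ k : ℤ, ‖(φ ((δ : ℂ) * hexCenter (top k)) - φ ((δ : ℂ) * hexMidpoint (ek k))) *
      (Z (ek k) / Z (ek kb))‖ ≤
      (L * δ / 2 * β ((δ : ℂ) * hexMidpoint (ek k))) * (‖Z (ek k)‖ / ‖Z (ek kb)‖) := by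
    intro k
    rw [norm_mul, norm_div]
    have hβk0 := hβ0 ((δ : ℂ) * hexMidpoint (ek k))
    refine mul_le_mul_of_nonneg_right ?_ (by positivity)
    have hdist : dist ((δ : ℂ) * hexCenter (top k)) ((δ : ℂ) * hexMidpoint (ek k)) ≤ δ / 2 := by
      rw [dist_smul_mesh hδ.le]
      have := dist_hexCenter_hexMidpoint_le (GateMass.floorEdge_mem_edgeSet k m)
        (Sym2.mem_mk_right (((![k, m - 1] : Site 2)), (1 : Fin 2)) (((![k, m] : Site 2)), (0 : Fin 2)))
      simp only [htop, hek]
      nlinarith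
    by_cases h0 : φ ((δ : ℂ) * hexCenter (top k)) - φ ((δ : ℂ) * hexMidpoint (ek k)) = 0
    · rw [h0, norm_zero]; positivity
    · -- one of the two values is non-zero: the scaled midpoint is close to the support
      have hnear : (δ : ℂ) * hexMidpoint (ek k) ∈ ball c (ρφ + δ / 2) := by
        by_cases h1 : φ ((δ : ℂ) * hexMidpoint (ek k)) = 0
        · have h2 : φ ((δ : ℂ) * hexCenter (top k)) ≠ 0 := fun h2 => h0 (by rw [h1, h2, sub_zero])
          have h3 := mem_ball.1 (hφs _ h2)
          rw [mem_ball]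
          have t1 := dist_triangle ((δ : ℂ) * hexMidpoint (ek k)) ((δ : ℂ) * hexCenter (top k)) c
          rw [dist_comm ((δ : ℂ) * hexMidpoint (ek k)) ((δ : ℂ) * hexCenter (top k))] at t1
          linarith
        · exact ball_subset_ball (by linarith) (hφs _ h1)
      have hβk := hβ1 _ hnear
      have hφd : ‖φ ((δ : ℂ) * hexCenter (top k)) - φ ((δ : ℂ) * hexMidpoint (ek k))‖ ≤ L * (δ / 2) := by
        refine (hφL _ _).trans (mul_le_mul_of_nonneg_left ?_ hL)
        rwa [← dist_eq_norm]
      calc ‖φ ((δ : ℂ) * hexCenter (top k)) - φ ((δ : ℂ) * hexMidpoint (ek k))‖ ≤ L * (δ / 2) * 1 := by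
            rw [mul_one]; exact hφd
        _ ≤ L * (δ / 2) * β ((δ : ℂ) * hexMidpoint (ek k)) := by gcongr
        _ = L * δ / 2 * β ((δ : ℂ) * hexMidpoint (ek k)) := by ring
  calc δ * ‖∑ k ∈ hKf.toFinset, (φ ((δ : ℂ) * hexCenter (top k)) - φ ((δ : ℂ) * hexMidpoint (ek k))) *
        (Z (ek k) / Z (ek kb))‖
      ≤ δ * ∑ k ∈ hKf.toFinset,
          (L * δ / 2 * β ((δ : ℂ) * hexMidpoint (ek k))) * (‖Z (ek k)‖ / ‖Z (ek kb)‖) :=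
        mul_le_mul_of_nonneg_left ((norm_sum_le _ _).trans (Finset.sum_le_sum fun k _ => hterm k)) hδ.le
    _ = L * δ / 2 * ((δ * ∑ k ∈ hKf.toFinset, β ((δ : ℂ) * hexMidpoint (ek k)) * ‖Z (ek k)‖) /
          ‖Z (ek kb)‖) := by
        rw [Finset.mul_sum, Finset.mul_sum, Finset.sum_div, Finset.mul_sum]
        exact Finset.sum_congr rfl fun k _ => by ring

/-! ### Registered form (sub-goal of `stub_gateDbarLimit`) -/

/-- **Registered sub-goal `gateDbar_boundaryAt`** (crux item stmt-CriticalPhenomena-14004, line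
`polygon-parity-squeeze`, stub `stub_gateDbarLimit`, mechanism (C)): registry form (one `∀`-term) of
`boundary_term_at` — at one mesh, `6δ·(gate dart sum)` equals `−i√3 ·` (the tested gate profile sum)
up to `O(δ)` times the bump-tested profile sum. [cite: DuminilCopinSmirnov2012, §3 (winding of walks to the boundary)] -/
theorem gateDbar_boundaryAt : ∀ (Λ : Finset HexVertex) (u w : HexVertex) (m kb : ℤ) (δ ρ L ρφ : ℝ) (c : ℂ) (φ : ℂ → ℂ) (β : ℂ → ℝ), hexDomainSimplyConnected Λ → hexGraph.Adj u w → u ∉ Λ → w ∈ Λ → 0 < δ → ρ / 4 + 2 * δ ≤ ρ → (∀ y : HexVertex, (δ : ℂ) * hexCenter y ∈ Metric.ball c ρ → (y ∈ Λ ↔ m ≤ y.1 1)) → ρ ≤ dist ((δ : ℂ) * hexMidpoint s(u, w)) c → (δ : ℂ) * hexMidpoint s((((![kb, m - 1] : Site 2)), (1 : Fin 2)), ((![kb, m] : Site 2), (0 : Fin 2))) ∈ Metric.ball c (ρ / 4) → 0 ≤ L → (∀ x y, ‖φ x - φ y‖ ≤ L * ‖x - y‖) → (∀ z, φ z ≠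 0 → z ∈ Metric.ball c ρφ) → ρφ + δ ≤ ρ / 4 → (∀ z, 0 ≤ β z) → (∀ z ∈ Metric.ball c (ρφ + δ / 2), 1 ≤ β z) → ‖6 * ((δ : ℂ) * ∑ v ∈ Λ, ∑ t ∈ (Literature.Barriers.CriticalPhenomena.HexGreen.nbrs v).filter (· ∉ Λ), φ ((δ : ℂ) * hexCenter v) * ((hexMidpoint s(v, t) - hexCenter v) * hexParafermionicObservable Λ s(u, w) hexCriticalFugacity (5 / 8) s(v, t)) / hexParafermionicObservable Λ s(u, w) hexCriticalFugacity (5 / 8) s((((![kb, m - 1] : Site 2)), (1 : Fin 2)), ((![kb, m] : Site 2), (0 : Fin 2)))) - -(Complex.I * (Real.sqrt 3 : ℂ)) * ((δ : ℂ) * ∑ᶠ e ∈ {e : Sym2 HexVertex | e ∈ hexDomainBoundary Λ ∧ (δ : ℂ) * hexMidpoint e ∈ Metric.ball c (ρ / 4)}, φ ((δ : ℂ) * hexMidpoint e) * (hexParafermionicObservable Λ s(u, w) hexCriticalFugacity 0 e / hexParafermionicObservable Λ s(u, w) hexCriticalFugacity 0 s((((![kb, m - 1] : Site 2)), (1 :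 Fin 2)), ((![kb, m] : Site 2), (0 : Fin 2)))))‖ ≤ Real.sqrt 3 * (L * δ / 2) * ((δ * ∑ᶠ e ∈ {e : Sym2 HexVertex | e ∈ hexDomainBoundary Λ ∧ (δ : ℂ) * hexMidpoint e ∈ Metric.ball c (ρ / 4)}, β ((δ : ℂ) * hexMidpoint e) * ‖hexParafermionicObservable Λ s(u, w) hexCriticalFugacity 0 e‖) / ‖hexParafermionicObservable Λ s(u, w) hexCriticalFugacity 0 s((((![kb, m - 1] : Site 2)), (1 : Fin 2)), ((![kb, m] : Site 2), (0 : Fin 2)))‖) :=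
  fun _ _ _ _ _ _ _ _ _ _ _ _ hΛ huw hu hw hδ hρδ hpin hfar hkb hL hφL hφs hρφ hβ0 hβ1 =>
    boundary_term_at hΛ huw hu hw hδ hρδ hpin hfar hkb hL hφL hφs hρφ hβ0 hβ1

end Summit.CriticalPhenomena.SAWScalingLimit.Theorems.PolygonParitySqueeze.GateDbar

end
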